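import Literature.AnabelianGeometry.SemiGraphs.TemperedCompactPairBridgeRelative
import HarnessLib

/-!
# Two subgroups of `π₁^temp(𝒢)` whose fixed loci stay at tree distance ONE are ANCHORED: verticially
# contained at adjacent compatible vertex systems, with intersection in an edge-like subgroup

Mochizuki, *Semi-graphs of anabelioids*, Publ. RIMS **42** (2006), §1, Lemma 1.8 (ii) p. 20, §3, Theorem 3.7
(iii)/(iv) pp. 40–41: "The nontrivial intersections of two distinct maximal compact subgroups of `π₁^temp(𝒢)` are
precisely the edge-like subgroups." [cite: MochizukiSemiAnbd2006, Thm 3.7(iv) p.41].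

PROOF-ONLY tool file (abc-iut cell, layer L3, row «T37iv-S2@RELATIVE-BRIDGE», file F2, seat abc-iut-L3-t8
gen 10; no definition, no named fact).  Sequel of `TemperedCompactPairBridgeRelative.lean` (F1: `(K₁ ⊔ K₂)‾` is
compact iff `K₁`, `K₂` fix a common vertex at every level).  Here: the regime in which the fixed loci of `K₁`
and `K₂` in the level trees `𝒢_{∞,M}` are DISJOINT but ADJACENT.  Call a *bridge of level `M`* a pair of
DISTINCT branches `β₁ ≠ β₂` of ONE edge `ε` of `𝒢_{∞,M}`, `β₁` abutting to a vertex `x` fixed by (every element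
of) `K₁` and `β₂` abutting to a vertex `y` fixed by `K₂` (spelled out in each statement; no definition).  For
ANY countable semi-graph of anabelioids `𝒢` satisfying the hypotheses of Prop. 3.6, canonical tower, ANY
subgroups `K₁, K₂ ≤ π₁^temp(𝒢)` (no compactness, no estrangement needed):

* `forall_not_common_fixed_of_le` — no common fixed vertex at level `m` ⇒ none at any level `M ≥ m`;
* `bridge_unique` — if `K₁`, `K₂` fix no common vertex of `𝒢_{∞,M}`, a bridge of level `M` is UNIQUE (the
  separating edge-point of Lemma 1.8 (ii), family form, lies on the walk `x – β₁ – ε – β₂ – y`; a swapped branch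
  would produce a common fixed vertex);
* `bridge_fixed_of_mem_inf` — hence every `g ∈ K₁ ⊓ K₂` FIXES the bridge (its edge and both branches);
* `bridge_trans` — bridges of levels `m ≤ M` correspond under the transition `𝒢_{∞,M} → 𝒢_{∞,m}`;
* `exists_verticial_ge_of_eventually_compatible_fixed` — (I2) for an eventually defined compatible fixed system;
* ★ `exists_verticial_ge_of_forall_exists_bridge`, ★ `exists_edgeLike_ge_inf_of_forall_exists_bridge` — if from
  some level `m` on `K₁`, `K₂` fix no common vertex but EVERY level `M ≥ m` carries a bridge, then `K₁` and `K₂`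
  lie in VERTICIAL subgroups (the compatible systems `(x_M)`, `(y_M)`; identification (I2) of the level data)
  and `K₁ ⊓ K₂` lies in an EDGE-LIKE subgroup of the common base edge of the bridges (identification (I3)).

With F1: the tree distance between the level fixed loci of two compact subgroups is non-decreasing; `≡ 0` iff
they generate a compact subgroup (F1); eventually `1` ⇒ anchored (here); eventually `≥ 2` = sequel.  Honest
framing: generic statements about OUR typed `π₁^temp`; nothing bears on [IUTchIII] Cor. 3.12; typed ≠ proved.
-/
noncomputable section

open CategoryTheory Topology

namespace Literature.AnabelianGeometry.SemiGraphs

open SimpleGraph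

universe u

namespace SemiGraph

variable {T : SemiGraph.{u}}

/-- Two distinct branches of one edge exhaust the branches of that edge (every edge has exactly two
branches). [cite: MochizukiSemiAnbd2006, §1 p.11] -/
theorem eq_or_eq_of_edgeOf_eq {β₁ β₂ b : T.Branch} (h12 : β₁ ≠ β₂) (he : T.edgeOf β₁ = T.edgeOf β₂)
    (hb : T.edgeOf b = T.edgeOf β₁) : b = β₁ ∨ b = β₂ := by
  obtain ⟨b₁, b₂, -, -, -, hall⟩ := T.two_branches (T.edgeOf β₁)
  rcases hall β₁ rfl with h₁ | h₁ <;> rcases hall β₂ he.symm with h₂ | h₂ <;>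
    rcases hall b hb with h | h
  · exact absurd (h₁.trans h₂.symm) h12
  · exact absurd (h₁.trans h₂.symm) h12
  · exact Or.inl (h.trans h₁.symm)
  · exact Or.inr (h.trans h₂.symm)
  · exact Or.inr (h.trans h₂.symm)
  · exact Or.inl (h.trans h₁.symm)
  · exact absurd (h₁.trans h₂.symm) h12
  · exact absurd (h₁.trans h₂.symm) h12

/-- The walk `x – β₁ – ε – β₂ – y` of the barycentric subdivision along one edge `ε` with branches `β₁`
(abutting to `x`) and `β₂` (abutting to `y`); its support. [cite: MochizukiSemiAnbd2006, §1 pp.11-12] -/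
theorem exists_walk_along_edge {x y : T.Vertex} {β₁ β₂ : T.Branch} (he : T.edgeOf β₁ = T.edgeOf β₂)
    (hx : T.abuts β₁ = some x) (hy : T.abuts β₂ = some y) :
    ∃ w : T.subdivision.Walk (Sum.inl x) (Sum.inl y),
      w.support = [Sum.inl x, Sum.inr (Sum.inr β₁), Sum.inr (Sum.inl (T.edgeOf β₁)), Sum.inr (Sum.inr β₂),
        Sum.inl y] := by
  have h1 : T.subdivision.Adj (Sum.inl x) (Sum.inr (Sum.inr β₁)) :=
    (T.subdivision_adj_inl_iff x _).mpr ⟨β₁, hx, rfl⟩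
  have h2 : T.subdivision.Adj (Sum.inr (Sum.inr β₁)) (Sum.inr (Sum.inl (T.edgeOf β₁))) :=
    (T.subdivision_adj_branch_iff β₁ _).mpr (Or.inl rfl)
  have h3 : T.subdivision.Adj (Sum.inr (Sum.inl (T.edgeOf β₁))) (Sum.inr (Sum.inr β₂)) :=
    (T.subdivision_adj_edge_iff _ _).mpr ⟨β₂, he.symm, rfl⟩
  have h4 : T.subdivision.Adj (Sum.inr (Sum.inr β₂)) (Sum.inl y) :=
    (T.subdivision_adj_branch_iff β₂ _).mpr (Or.inr ⟨y, hy, rfl⟩)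
  exact ⟨Walk.cons h1 (Walk.cons h2 (Walk.cons h3 (Walk.cons h4 Walk.nil))), by simp⟩

end SemiGraph

namespace ProfiniteSemiGraph

variable {𝒢 : ProfiniteSemiGraph.{u}}

/-! ### No common fixed vertex is inherited by deeper levels -/

/-- If `K₁` and `K₂` fix no common vertex of `𝒢_{∞,m}`, they fix no common vertex of `𝒢_{∞,M}` for any
`M ≥ m` (a common fixed vertex of `𝒢_{∞,M}` projects to one of `𝒢_{∞,m}`, the transitions being equivariant).
[cite: MochizukiSemiAnbd2006, Thm 3.7(iii) p.41] -/
theorem forall_not_common_fixed_of_le (h36 : 𝒢.Prop36Hypotheses)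
    (K₁ K₂ : Subgroup ((𝒢.galoisLevelData h36).temperedPi h36.isCountable)) {m M : ℕ} (hmM : m ≤ M)
    (hno : ∀ z : ((𝒢.galoisLevelData h36).tree m).Vertex,
      (∀ k ∈ K₁, ((𝒢.galoisLevelData h36).treeAct h36.isCountable m k).hom.vertexMap z = z) →
        ¬ ∀ k ∈ K₂, ((𝒢.galoisLevelData h36).treeAct h36.isCountable m k).hom.vertexMap z = z)
    (z : ((𝒢.galoisLevelData h36).tree M).Vertex)
    (hz₁ : ∀ k ∈ K₁, ((𝒢.galoisLevelData h36).treeAct h36.isCountable M k).hom.vertexMap z = z) :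
    ¬ ∀ k ∈ K₂, ((𝒢.galoisLevelData h36).treeAct h36.isCountable M k).hom.vertexMap z = z := by
  let Dg := 𝒢.galoisLevelData h36
  have hc := h36.isCountable
  let D₀ : VerticialLevelData.{0} 𝒢 (𝒢.temperedPiChart h36) := verticialLevelData_temperedPiChart (h36 := h36)
  have hpush : ∀ k : Dg.temperedPi hc, (Dg.treeAct hc M k).hom.vertexMap z = z →
      (Dg.treeAct hc m k).hom.vertexMap ((Dg.treeTrans hmM).vertexMap z) = (Dg.treeTrans hmM).vertexMap z := by
    intro k hk
    have h : (Dg.treeTrans hmM).vertexMap ((Dg.treeAct hc M k).hom.vertexMap z) =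
        (Dg.treeAct hc m k).hom.vertexMap ((Dg.treeTrans hmM).vertexMap z) := D₀.trans_act_vertexMap hmM k z
    rw [hk] at h
    exact h.symm
  intro hz₂
  exact hno _ (fun k hk => hpush k (hz₁ k hk)) (fun k hk => hpush k (hz₂ k hk))

/-! ### A bridge of level `M` is unique -/

/-- **Uniqueness of the bridge.**  If `K₁` and `K₂` fix no common vertex of `𝒢_{∞,M}`, then a pair of distinct
branches `β₁ ≠ β₂` of one edge, `β₁` abutting to a `K₁`-fixed vertex and `β₂` to a `K₂`-fixed vertex, is
UNIQUE: the separating edge-point `e₀` of Lemma 1.8 (ii) (family form) lies on the walk `x – β₁ – ε – β₂ – y`,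
so `ε = e₀`; and the branch of `ε` towards `K₁` is forced, since otherwise `x' = y` would be a common fixed
vertex.  No compactness of `K₁`, `K₂` is needed. [cite: MochizukiSemiAnbd2006, Lem. 1.8(ii)(b) p.20] -/
theorem bridge_unique (h36 : 𝒢.Prop36Hypotheses)
    (K₁ K₂ : Subgroup ((𝒢.galoisLevelData h36).temperedPi h36.isCountable)) (M : ℕ)
    (hno : ∀ z : ((𝒢.galoisLevelData h36).tree M).Vertex,
      (∀ k ∈ K₁, ((𝒢.galoisLevelData h36).treeAct h36.isCountable M k).hom.vertexMap z = z) →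
        ¬ ∀ k ∈ K₂, ((𝒢.galoisLevelData h36).treeAct h36.isCountable M k).hom.vertexMap z = z)
    {x y x' y' : ((𝒢.galoisLevelData h36).tree M).Vertex}
    {β₁ β₂ β₁' β₂' : ((𝒢.galoisLevelData h36).tree M).Branch}
    (h12 : β₁ ≠ β₂) (he : ((𝒢.galoisLevelData h36).tree M).edgeOf β₁ = ((𝒢.galoisLevelData h36).tree M).edgeOf β₂)
    (hx : ((𝒢.galoisLevelData h36).tree M).abuts β₁ = some x)
    (hy : ((𝒢.galoisLevelData h36).tree M).abuts β₂ = some y)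
    (hxK : ∀ k ∈ K₁, ((𝒢.galoisLevelData h36).treeAct h36.isCountable M k).hom.vertexMap x = x)
    (hyK : ∀ k ∈ K₂, ((𝒢.galoisLevelData h36).treeAct h36.isCountable M k).hom.vertexMap y = y)
    (he' : ((𝒢.galoisLevelData h36).tree M).edgeOf β₁' = ((𝒢.galoisLevelData h36).tree M).edgeOf β₂')
    (hx' : ((𝒢.galoisLevelData h36).tree M).abuts β₁' = some x')
    (hy' : ((𝒢.galoisLevelData h36).tree M).abuts β₂' = some y')
    (hxK' : ∀ k ∈ K₁, ((𝒢.galoisLevelData h36).treeAct h36.isCountable M k).hom.vertexMap x' = x')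
    (hyK' : ∀ k ∈ K₂, ((𝒢.galoisLevelData h36).treeAct h36.isCountable M k).hom.vertexMap y' = y') :
    β₁' = β₁ ∧ β₂' = β₂ := by
  classical
  let Dg := 𝒢.galoisLevelData h36
  have hc := h36.isCountable
  -- the separating edge-point `e₀` of level `M`
  obtain ⟨e₀, he₀⟩ := SemiGraph.exists_edge_forall_walk_mem_support_of_family' (Dg.isTree_tree M)
    ((fun k => Dg.treeAct hc M k) '' (K₁ : Set (Dg.temperedPi hc)))
    ((fun k => Dg.treeAct hc M k) '' (K₂ : Set (Dg.temperedPi hc)))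
    (by
      rintro _ ⟨k, -, rfl⟩ e hef β hβ
      exact SemiGraph.branchMap_eq_of_over_aut (Dg.treeProj M) (Dg.treeAct hc M k) (Dg.treeAct_over hc M k) β
        (by rw [hβ]; exact hef))
    (by
      rintro _ ⟨k, -, rfl⟩ e hef β hβ
      exact SemiGraph.branchMap_eq_of_over_aut (Dg.treeProj M) (Dg.treeAct hc M k) (Dg.treeAct_over hc M k) β
        (by rw [hβ]; exact hef))
    (a₀ := x) (b₀ := y)
    (by rintro _ ⟨k, hk, rfl⟩; exact hxK k hk) (by rintro _ ⟨k, hk, rfl⟩; exact hyK k hk)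
    (by
      intro z hz hz'
      exact hno z (fun k hk => hz _ ⟨k, hk, rfl⟩) (fun k hk => hz' _ ⟨k, hk, rfl⟩))
  -- `e₀` lies on both walks along the bridges, hence is the edge of both
  have hedge : ∀ {a b : (Dg.tree M).Vertex} {γ₁ γ₂ : (Dg.tree M).Branch},
      (Dg.tree M).edgeOf γ₁ = (Dg.tree M).edgeOf γ₂ → (Dg.tree M).abuts γ₁ = some a →
      (Dg.tree M).abuts γ₂ = some b → (∀ k ∈ K₁, (Dg.treeAct hc M k).hom.vertexMap a = a) →
      (∀ k ∈ K₂, (Dg.treeAct hc M k).hom.vertexMap b = b) → (Dg.tree M).edgeOf γ₁ = e₀ := by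
    intro a b γ₁ γ₂ hγe ha hb haK hbK
    obtain ⟨w, hw⟩ := SemiGraph.exists_walk_along_edge hγe ha hb
    have hmem := he₀ a b (by rintro _ ⟨k, hk, rfl⟩; exact haK k hk) (by rintro _ ⟨k, hk, rfl⟩; exact hbK k hk) w
    rw [hw] at hmem
    simp only [List.mem_cons, Sum.inr.injEq, Sum.inl.injEq, reduceCtorEq, List.not_mem_nil, or_false,
      false_or] at hmem
    exact hmem.symm
  have hee : (Dg.tree M).edgeOf β₁' = (Dg.tree M).edgeOf β₁ :=
    (hedge he' hx' hy' hxK' hyK').trans (hedge he hx hy hxK hyK).symm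
  -- the branch assignment is forced
  have h1 : β₁' = β₁ := by
    rcases SemiGraph.eq_or_eq_of_edgeOf_eq h12 he hee with h | h
    · exact h
    · exfalso
      -- `β₁' = β₂`: then `x' = y` is a common fixed vertex
      have hxy : x' = y := Option.some.inj ((h ▸ hx').symm.trans hy)
      exact hno y (fun k hk => hxy ▸ hxK' k hk) hyK
  have h2 : β₂' = β₂ := by
    rcases SemiGraph.eq_or_eq_of_edgeOf_eq h12 he (he'.symm.trans hee) with h | h
    · exfalso
      -- `β₂' = β₁`: then `y' = x` is a common fixed vertex
      have hxy : y' = x := Option.some.inj ((h ▸ hy').symm.trans hx)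
      exact hno x hxK (fun k hk => hxy ▸ hyK' k hk)
    · exact h
  exact ⟨h1, h2⟩

/-- **Every element of `K₁ ⊓ K₂` fixes the bridge** (its edge and both its branches): it maps the bridge to a
bridge, which is unique. [cite: MochizukiSemiAnbd2006, Lem. 1.8(ii)(b) p.20] -/
theorem bridge_fixed_of_mem_inf (h36 : 𝒢.Prop36Hypotheses)
    (K₁ K₂ : Subgroup ((𝒢.galoisLevelData h36).temperedPi h36.isCountable)) (M : ℕ)
    (hno : ∀ z : ((𝒢.galoisLevelData h36).tree M).Vertex,
      (∀ k ∈ K₁, ((𝒢.galoisLevelData h36).treeAct h36.isCountable M k).hom.vertexMap z = z) →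
        ¬ ∀ k ∈ K₂, ((𝒢.galoisLevelData h36).treeAct h36.isCountable M k).hom.vertexMap z = z)
    {x y : ((𝒢.galoisLevelData h36).tree M).Vertex} {β₁ β₂ : ((𝒢.galoisLevelData h36).tree M).Branch}
    (h12 : β₁ ≠ β₂) (he : ((𝒢.galoisLevelData h36).tree M).edgeOf β₁ = ((𝒢.galoisLevelData h36).tree M).edgeOf β₂)
    (hx : ((𝒢.galoisLevelData h36).tree M).abuts β₁ = some x)
    (hy : ((𝒢.galoisLevelData h36).tree M).abuts β₂ = some y)
    (hxK : ∀ k ∈ K₁, ((𝒢.galoisLevelData h36).treeAct h36.isCountable M k).hom.vertexMap x = x)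
    (hyK : ∀ k ∈ K₂, ((𝒢.galoisLevelData h36).treeAct h36.isCountable M k).hom.vertexMap y = y)
    {g : (𝒢.galoisLevelData h36).temperedPi h36.isCountable} (hg₁ : g ∈ K₁) (hg₂ : g ∈ K₂) :
    ((𝒢.galoisLevelData h36).treeAct h36.isCountable M g).hom.branchMap β₁ = β₁ ∧
      ((𝒢.galoisLevelData h36).treeAct h36.isCountable M g).hom.branchMap β₂ = β₂ ∧
      ((𝒢.galoisLevelData h36).treeAct h36.isCountable M g).hom.edgeMap
        (((𝒢.galoisLevelData h36).tree M).edgeOf β₁) = ((𝒢.galoisLevelData h36).tree M).edgeOf β₁ := by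
  let Dg := 𝒢.galoisLevelData h36
  have hc := h36.isCountable
  let σ := Dg.treeAct hc M g
  -- the image of the bridge under `g` is a bridge (a second branch pair on an edge between the fixed loci)
  have heg : (Dg.tree M).edgeOf (σ.hom.branchMap β₁) = (Dg.tree M).edgeOf (σ.hom.branchMap β₂) := by
    rw [σ.hom.edgeOf_branchMap, σ.hom.edgeOf_branchMap, he]
  have hxg : (Dg.tree M).abuts (σ.hom.branchMap β₁) = some x := by
    rw [σ.hom.abuts_branchMap β₁ x hx, hxK g hg₁]
  have hyg : (Dg.tree M).abuts (σ.hom.branchMap β₂) = some y := by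
    rw [σ.hom.abuts_branchMap β₂ y hy, hyK g hg₂]
  obtain ⟨h1, h2⟩ := bridge_unique h36 K₁ K₂ M hno h12 he hx hy hxK hyK heg hxg hyg hxK hyK
  exact ⟨h1, h2, by rw [← σ.hom.edgeOf_branchMap, h1]⟩

/-! ### Bridges of different levels correspond under the transitions -/

/-- **Bridges descend**: if `K₁` and `K₂` fix no common vertex of `𝒢_{∞,m}`, then for `m ≤ M` the transition
`𝒢_{∞,M} → 𝒢_{∞,m}` maps a bridge of level `M` onto THE bridge of level `m` (its image is a bridge — branches
of one edge map injectively, abutments and fixed vertices are preserved — and bridges are unique).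
[cite: MochizukiSemiAnbd2006, Thm 3.7(iii) p.41] -/
theorem bridge_trans (h36 : 𝒢.Prop36Hypotheses)
    (K₁ K₂ : Subgroup ((𝒢.galoisLevelData h36).temperedPi h36.isCountable)) {m M : ℕ} (hmM : m ≤ M)
    (hno : ∀ z : ((𝒢.galoisLevelData h36).tree m).Vertex,
      (∀ k ∈ K₁, ((𝒢.galoisLevelData h36).treeAct h36.isCountable m k).hom.vertexMap z = z) →
        ¬ ∀ k ∈ K₂, ((𝒢.galoisLevelData h36).treeAct h36.isCountable m k).hom.vertexMap z = z)
    {x y : ((𝒢.galoisLevelData h36).tree M).Vertex} {β₁ β₂ : ((𝒢.galoisLevelData h36).tree M).Branch}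
    (he : ((𝒢.galoisLevelData h36).tree M).edgeOf β₁ = ((𝒢.galoisLevelData h36).tree M).edgeOf β₂)
    (hx : ((𝒢.galoisLevelData h36).tree M).abuts β₁ = some x)
    (hy : ((𝒢.galoisLevelData h36).tree M).abuts β₂ = some y)
    (hxK : ∀ k ∈ K₁, ((𝒢.galoisLevelData h36).treeAct h36.isCountable M k).hom.vertexMap x = x)
    (hyK : ∀ k ∈ K₂, ((𝒢.galoisLevelData h36).treeAct h36.isCountable M k).hom.vertexMap y = y)
    {x' y' : ((𝒢.galoisLevelData h36).tree m).Vertex} {β₁' β₂' : ((𝒢.galoisLevelData h36).tree m).Branch}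
    (h12' : β₁' ≠ β₂')
    (he' : ((𝒢.galoisLevelData h36).tree m).edgeOf β₁' = ((𝒢.galoisLevelData h36).tree m).edgeOf β₂')
    (hx' : ((𝒢.galoisLevelData h36).tree m).abuts β₁' = some x')
    (hy' : ((𝒢.galoisLevelData h36).tree m).abuts β₂' = some y')
    (hxK' : ∀ k ∈ K₁, ((𝒢.galoisLevelData h36).treeAct h36.isCountable m k).hom.vertexMap x' = x')
    (hyK' : ∀ k ∈ K₂, ((𝒢.galoisLevelData h36).treeAct h36.isCountable m k).hom.vertexMap y' = y') :
    ((𝒢.galoisLevelData h36).treeTrans hmM).branchMap β₁ = β₁' ∧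
      ((𝒢.galoisLevelData h36).treeTrans hmM).branchMap β₂ = β₂' ∧
      ((𝒢.galoisLevelData h36).treeTrans hmM).vertexMap x = x' ∧
      ((𝒢.galoisLevelData h36).treeTrans hmM).vertexMap y = y' := by
  let Dg := 𝒢.galoisLevelData h36
  have hc := h36.isCountable
  let D₀ : VerticialLevelData.{0} 𝒢 (𝒢.temperedPiChart h36) := verticialLevelData_temperedPiChart (h36 := h36)
  let π := Dg.treeTrans hmM
  have hpush : ∀ (k : Dg.temperedPi hc) (z : (Dg.tree M).Vertex), (Dg.treeAct hc M k).hom.vertexMap z = z →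
      (Dg.treeAct hc m k).hom.vertexMap (π.vertexMap z) = π.vertexMap z := by
    intro k z hk
    have h : π.vertexMap ((Dg.treeAct hc M k).hom.vertexMap z) =
        (Dg.treeAct hc m k).hom.vertexMap (π.vertexMap z) := D₀.trans_act_vertexMap hmM k z
    rw [hk] at h
    exact h.symm
  -- the image of the bridge lies on an edge between the fixed loci of level `m`
  have heπ : (Dg.tree m).edgeOf (π.branchMap β₁) = (Dg.tree m).edgeOf (π.branchMap β₂) := by
    rw [π.edgeOf_branchMap, π.edgeOf_branchMap, he]
  have hxπ : (Dg.tree m).abuts (π.branchMap β₁) = some (π.vertexMap x) := π.abuts_branchMap β₁ x hx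
  have hyπ : (Dg.tree m).abuts (π.branchMap β₂) = some (π.vertexMap y) := π.abuts_branchMap β₂ y hy
  obtain ⟨h1, h2⟩ := bridge_unique h36 K₁ K₂ m hno h12' he' hx' hy' hxK' hyK' heπ hxπ hyπ
    (fun k hk => hpush k x (hxK k hk)) (fun k hk => hpush k y (hyK k hk))
  refine ⟨h1, h2, ?_, ?_⟩
  · exact Option.some.inj ((h1 ▸ hxπ).symm.trans hx')
  · exact Option.some.inj ((h2 ▸ hyπ).symm.trans hy')

/-! ### An eventually defined compatible fixed vertex system lies under a verticial subgroup -/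

/-- **(I2) for an EVENTUALLY defined system**: if `z_M` (`M ≥ m`) are vertices of the `𝒢_{∞,M}`, compatible
under the transitions and each fixed by every element of `K`, then `K` lies in a VERTICIAL subgroup (extend the
system to all levels by projection and apply the identification (I2) of the level data: "the unique elements …
form a compatible system of vertices fixed by `H`. Thus … `H` is contained in some verticial subgroup", the author's
Comments (May 2020) (6)(a) on p. 41). [cite: MochizukiSemiAnbd2006, Thm 3.7(iii) p.41] -/
theorem exists_verticial_ge_of_eventually_compatible_fixed (h36 : 𝒢.Prop36Hypotheses)
    (K : Subgroup ((𝒢.galoisLevelData h36).temperedPi h36.isCountable)) (m : ℕ)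
    (z : ∀ M : ℕ, m ≤ M → ((𝒢.galoisLevelData h36).tree M).Vertex)
    (hz : ∀ {M M' : ℕ} (hM : m ≤ M) (hMM' : M ≤ M'),
      ((𝒢.galoisLevelData h36).treeTrans hMM').vertexMap (z M' (hM.trans hMM')) = z M hM)
    (hzK : ∀ (M : ℕ) (hM : m ≤ M), ∀ k ∈ K,
      ((𝒢.galoisLevelData h36).treeAct h36.isCountable M k).hom.vertexMap (z M hM) = z M hM) :
    ∃ (v : 𝒢.graph.Vertex) (H : Subgroup (𝒢.temperedPiChart h36).G),
      H ∈ verticialSubgroups (𝒢.temperedPiChart h36) v ∧ K ≤ H := by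
  classical
  let Dg := 𝒢.galoisLevelData h36
  have hc := h36.isCountable
  let D₀ : VerticialLevelData.{0} 𝒢 (𝒢.temperedPiChart h36) := verticialLevelData_temperedPiChart (h36 := h36)
  -- the system extended to all levels: at level `j`, the image of `z_{max j m}`
  let zs : ∀ j : ℕ, (Dg.tree j).Vertex := fun j =>
    (Dg.treeTrans (le_max_left j m)).vertexMap (z (max j m) (le_max_right j m))
  have hcompat : ∀ ⦃i j : ℕ⦄ (h : i ≤ j), (Dg.treeTrans h).vertexMap (zs j) = zs i := by
    intro i j h
    have hij : max i m ≤ max j m := max_le_max h le_rfl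
    have h1 : (Dg.treeTrans h).vertexMap (zs j) =
        (Dg.treeTrans (h.trans (le_max_left j m))).vertexMap (z (max j m) (le_max_right j m)) :=
      D₀.trans_vertexMap_comp h (le_max_left j m) _
    have h2 : zs i = (Dg.treeTrans ((le_max_left i m).trans hij)).vertexMap
        (z (max j m) ((le_max_right i m).trans hij)) := by
      change (Dg.treeTrans (le_max_left i m)).vertexMap (z (max i m) (le_max_right i m)) = _
      rw [← hz (le_max_right i m) hij]
      exact D₀.trans_vertexMap_comp _ _ _
    rw [h1, h2]
  have hfix : ∀ g ∈ K, ∀ j, (Dg.treeAct hc j g).hom.vertexMap (zs j) = zs j := by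
    intro g hg j
    have h : (Dg.treeTrans (le_max_left j m)).vertexMap
        ((Dg.treeAct hc (max j m) g).hom.vertexMap (z (max j m) (le_max_right j m))) =
        (Dg.treeAct hc j g).hom.vertexMap (zs j) :=
      D₀.trans_act_vertexMap (le_max_left j m) g _
    rw [hzK _ _ g hg] at h
    exact h.symm
  obtain ⟨v, H, hH, hstab⟩ := D₀.stab zs hcompat
  exact ⟨v, H, hH, fun g hg => hstab g (hfix g hg)⟩

/-! ### ★ The distance-one regime is anchored -/

section Anchored

variable (h36 : 𝒢.Prop36Hypotheses)
  (K₁ K₂ : Subgroup ((𝒢.galoisLevelData h36).temperedPi h36.isCountable)) (m : ℕ)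
  (hno : ∀ z : ((𝒢.galoisLevelData h36).tree m).Vertex,
    (∀ k ∈ K₁, ((𝒢.galoisLevelData h36).treeAct h36.isCountable m k).hom.vertexMap z = z) →
      ¬ ∀ k ∈ K₂, ((𝒢.galoisLevelData h36).treeAct h36.isCountable m k).hom.vertexMap z = z)
  (hbr : ∀ M : ℕ, m ≤ M → ∃ (x y : ((𝒢.galoisLevelData h36).tree M).Vertex)
    (β₁ β₂ : ((𝒢.galoisLevelData h36).tree M).Branch), β₁ ≠ β₂ ∧
      ((𝒢.galoisLevelData h36).tree M).edgeOf β₁ = ((𝒢.galoisLevelData h36).tree M).edgeOf β₂ ∧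
      ((𝒢.galoisLevelData h36).tree M).abuts β₁ = some x ∧
      ((𝒢.galoisLevelData h36).tree M).abuts β₂ = some y ∧
      (∀ k ∈ K₁, ((𝒢.galoisLevelData h36).treeAct h36.isCountable M k).hom.vertexMap x = x) ∧
      ∀ k ∈ K₂, ((𝒢.galoisLevelData h36).treeAct h36.isCountable M k).hom.vertexMap y = y)

include hno hbr

/-- ★ **In the distance-one regime `K₁` and `K₂` lie in VERTICIAL subgroups.**  If `K₁` and `K₂` fix no common
vertex of `𝒢_{∞,m}` but every level `M ≥ m` carries a bridge (an edge with one end fixed by `K₁` and the other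
by `K₂`), then the `K₁`-ends `x_M` and the `K₂`-ends `y_M` of the (unique) bridges form COMPATIBLE systems of
tree vertices fixed by `K₁`, resp. `K₂` (`bridge_trans`), so each lies in a verticial subgroup by (I2).
[cite: MochizukiSemiAnbd2006, Thm 3.7(iii) p.41] -/
theorem exists_verticial_ge_of_forall_exists_bridge :
    (∃ (v : 𝒢.graph.Vertex) (H : Subgroup (𝒢.temperedPiChart h36).G),
      H ∈ verticialSubgroups (𝒢.temperedPiChart h36) v ∧ K₁ ≤ H) ∧
    ∃ (v : 𝒢.graph.Vertex) (H : Subgroup (𝒢.temperedPiChart h36).G),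
      H ∈ verticialSubgroups (𝒢.temperedPiChart h36) v ∧ K₂ ≤ H := by
  classical
  choose x y β₁ β₂ h12 he hx hy hxK hyK using hbr
  have hdesc : ∀ {M M' : ℕ} (hM : m ≤ M) (hMM' : M ≤ M'),
      ((𝒢.galoisLevelData h36).treeTrans hMM').vertexMap (x M' (hM.trans hMM')) = x M hM ∧
      ((𝒢.galoisLevelData h36).treeTrans hMM').vertexMap (y M' (hM.trans hMM')) = y M hM := by
    intro M M' hM hMM'
    exact (bridge_trans h36 K₁ K₂ hMM' (forall_not_common_fixed_of_le h36 K₁ K₂ hM hno)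
      (he M' (hM.trans hMM')) (hx M' (hM.trans hMM')) (hy M' (hM.trans hMM')) (hxK M' (hM.trans hMM'))
      (hyK M' (hM.trans hMM')) (h12 M hM) (he M hM) (hx M hM) (hy M hM) (hxK M hM) (hyK M hM)).2.2
  exact ⟨exists_verticial_ge_of_eventually_compatible_fixed h36 K₁ m x (fun hM hMM' => (hdesc hM hMM').1) hxK,
    exists_verticial_ge_of_eventually_compatible_fixed h36 K₂ m y (fun hM hMM' => (hdesc hM hMM').2) hyK⟩

/-- ★ **In the distance-one regime `K₁ ⊓ K₂` lies in an EDGE-LIKE subgroup** of the common base edge of the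
bridges: every `g ∈ K₁ ⊓ K₂` fixes the unique bridge of every level `M ≥ m` together with its branches
(`bridge_fixed_of_mem_inf`), the bridge edges form a compatible system (`bridge_trans`), and the stabiliser of
an eventual compatible edge system lies in an edge-like subgroup by the identification (I3) of the level data
("a compatible system of closed edges fixed by `H` … `H` is contained in some edge-like subgroup", the author's
Comments (May 2020) (6)(b) on p. 41). [cite: MochizukiSemiAnbd2006, Thm 3.7(iv) p.41] -/
theorem exists_edgeLike_ge_inf_of_forall_exists_bridge :
    ∃ (e : 𝒢.graph.Edge) (L : Subgroup (𝒢.temperedPiChart h36).G),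
      L ∈ edgeLikeSubgroups (𝒢.temperedPiChart h36) e ∧ K₁ ⊓ K₂ ≤ L := by
  classical
  let Dg := 𝒢.galoisLevelData h36
  have hc := h36.isCountable
  let D₀ : VerticialLevelData.{0} 𝒢 (𝒢.temperedPiChart h36) := verticialLevelData_temperedPiChart (h36 := h36)
  choose x y β₁ β₂ h12 he hx hy hxK hyK using hbr
  -- the eventual compatible system of bridge edges
  let ε : ∀ j : {j : ℕ // m ≤ j}, (Dg.tree j.1).Edge := fun j => (Dg.tree j.1).edgeOf (β₁ j.1 j.2)
  have hε : ∀ ⦃i j : {j : ℕ // m ≤ j}⦄ (h : i.1 ≤ j.1), (Dg.treeTrans h).edgeMap (ε j) = ε i := by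
    intro i j h
    have hb := (bridge_trans h36 K₁ K₂ h (forall_not_common_fixed_of_le h36 K₁ K₂ i.2 hno)
      (he j.1 j.2) (hx j.1 j.2) (hy j.1 j.2) (hxK j.1 j.2) (hyK j.1 j.2)
      (h12 i.1 i.2) (he i.1 i.2) (hx i.1 i.2) (hy i.1 i.2) (hxK i.1 i.2) (hyK i.1 i.2)).1
    change (Dg.treeTrans h).edgeMap ((Dg.tree j.1).edgeOf (β₁ j.1 j.2)) = (Dg.tree i.1).edgeOf (β₁ i.1 i.2)
    rw [← (Dg.treeTrans h).edgeOf_branchMap, hb]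
  obtain ⟨e, L, hL, -, hstab⟩ := D₀.edge m ε hε
  refine ⟨e, L, hL, fun g hg => hstab g fun j => ?_⟩
  obtain ⟨hg₁, hg₂⟩ := Subgroup.mem_inf.mp hg
  obtain ⟨hb₁, hb₂, hεg⟩ := bridge_fixed_of_mem_inf h36 K₁ K₂ j.1
    (forall_not_common_fixed_of_le h36 K₁ K₂ j.2 hno) (h12 j.1 j.2) (he j.1 j.2) (hx j.1 j.2) (hy j.1 j.2)
    (hxK j.1 j.2) (hyK j.1 j.2) hg₁ hg₂
  refine ⟨hεg, fun b hb => ?_⟩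
  rcases SemiGraph.eq_or_eq_of_edgeOf_eq (h12 j.1 j.2) (he j.1 j.2) hb with rfl | rfl
  · exact hb₁
  · exact hb₂

end Anchored

end ProfiniteSemiGraph

end Literature.AnabelianGeometry.SemiGraphs

end
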